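import Summits.QuantumFields.BalabanUV.Beta.CombChartStepJets
import Summits.QuantumFields.BalabanUV.Beta.RelInvCombShiftedSpread
import Summits.QuantumFields.BalabanUV.Beta.ChartConjugationRemainderEnd
import Summits.QuantumFields.BalabanUV.Beta.SymmetrisedDressingHessian
import Summits.QuantumFields.BalabanUV.Beta.AxialDressingRootedHessian
import Summits.QuantumFields.BalabanUV.Beta.DiagonalContact

/-!
# `BalabanUV.Beta.CombChartJointEnd` — binder row D1, RULING R-D1-g35-1 (repair route (β) = CHART (III′)), brick P4-E′: **THE CHART-(III′) ROW END AT
# JetData LEVEL** — the END-ready literal `JsB12CombShSym := dressSymAt ρ_c ∘ JsB12CombSh` (P3's `dressAt ρ_c ∘ JsB12CombSh⁰`, then the block-mean sym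
# dressing), the KERNEL IDENTITY `TbalOf Lc JsB12CombShSym j = hessKer (G′_j) (vertexOfK G′_j Lc (JsB12CombSh⁰ j).S) (JsB12CombSh⁰ j).W` with
# `G′_j = GcombSh Lc j = coDressKAt ρ_c Lc (Gsym Lc j)` (so the Hessian kernel's resolvent IS the resolvent of P2's relative-inverse socket), and the
# reflection-covariance binder **hR ⟸ (Sr-conj) ∧ (Wr-conj-rem) of the UNDRESSED comb-chart jets with DIAGONAL contacts and a tadpole-null remainder —
# NO compensator, NO `conjDefect`, NO `hcomp` word** (`ChartConjugationRemainderEnd.axisReflectionCovariant_flipK_hessKer_conj_rem_rel` at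
# `(K, 𝕄, E) := (GcombSh Lc j, bhKStepSh 3 Lc (Dsh Lc) j, axEc ρ_c Lc)`, its `hR` socket DISCHARGED by P2 `RelInvCombShiftedSpread.relInv_coDressKAt_Gsym_bhKStepSh`,
# `hKr` by `CombChartResolventRules.refK_coDressKAt_Gsym`, `hEC`∕`hEX₂` by leaf-03's `DiagonalContact.comp_axEc_diagK_comm`); then the row's END
# `D1Drift Lc (JsB12CombShSym …) Nc μ ν ⟸ hW ∧ (Sr-conj) ∧ (Wr-conj-rem) ∧ D1Tel ∧ D1Rep` (`OneStepKernelFamily.d1Drift_of_D1Tel_D1Rep`)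
# (β sub-cell, BINDER-OWNERS row D1 OWNER `b2b-balaban-beta-an2` gen 36; the (III′) sibling of ROOT E `RowD1JointEndSym` §1–§2 + `RowD1JointEndSymLiteral`)

HONEST FRAMING (cell contract, verbatim): «discharging `BetaPertH` makes Bałaban's UV stability UNCONDITIONAL — a real constructive-QFT
result; it is NOT the continuum limit and NOT the Clay problem.»  HONEST DEPENDENCY: continuum YM on T⁴ ⇐ BetaPertH ∧ nine spine estimates (0/9 proved);
BetaPertH ⇐ (D1) ∧ (D4) ∧ CAP+tail; G-an2-4 gates asym, D1 and NE2/3/4.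
DERIVED cell leaf ([folklore] wiring BY NAME + ONE data def = a NAME for a composite of two landed dressing functors applied to P3's literal).  No statement of
Bałaban's papers, no `[cite:]`, no `Prop` fact.  THIS IS THE REPAIR TRACK, NOT (yet) the literal OF RECORD: ROOT M′ p303989 over `JsB12Sym` (chart (II)) stays the
record until the (III′) END is discharged (RULING R-D1-g35-1 (5), REFEREE #67's re-rooting protocol).

LOCATED FINDING THAT SHAPES THIS FILE (owner, gen 36).  By `AxialDressingRootedHessian.TbalOf_dressAt` the Hessian kernel of P3's comb-dressed family
`JsB12CombSh = dressAt ρ_c ∘ JsB12CombSh⁰` has resolvent `coDressKAt ρ_c Lc (KInvStep Lc j)` — the comb-dressed RAW step resolvent, which resolves the leg-FREE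
border `bhKStep` on the comb slice, NOT the legged border `bhKStepSh 3 Lc (Dsh Lc) j` of an1's (0.4) tables (the legs are not null on `axEc`, an3 XAN262-AN3 §1);
the relative-inverse socket IN THE TREE is P2's, for `G′_j = coDressKAt ρ_c Lc (Gsym Lc j)`.  The family whose Hessian kernel has resolvent `G′_j` is obtained
by ONE MORE landed dressing functor: `TstepOf Lc j (dressSymAt ρ_c J) = hessKer (Gsym Lc j) …` (`SymmetrisedDressingHessian.TstepOf_dressSymAt`) and
`hessKer K … (dressAt ρ_c J⁰) … = hessKer (coDressKAt ρ_c Lc K) … J⁰ …` for ANY decaying `K` (`AxialDressingRootedHessian.hessKer_dressAt` at `K := Gsym Lc j`)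
give §2.  So the END-ready (III′) literal is `dressSymAt ρ_c ∘ dressAt ρ_c ∘ JsB12CombSh⁰` — §1 names it.

WHAT (`d + 1 = 4`, `Lc` odd where reflection enters):
* §1 [our object] **`JsB12CombShSym hLc N tabs cΛ cB := fun j ↦ dressSymAt ρ_c (JsB12CombSh hLc N tabs cΛ cB j)`** (`rfl` unfoldings).
* §2 **`TbalOf_dressSymAt_dressAt`** (generic undressed jets `Js⁰`): `TbalOf Lc (dressSymAt ρ_c ∘ dressAt ρ_c ∘ Js⁰) j = hessKer (GcombSh Lc j)
  (vertexOfK (GcombSh Lc j) Lc (Js⁰ j).S) (Js⁰ j).W`; **`TbalOf_JsB12CombShSym`** (the instance).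
* §3 **`axisReflectionCovariant_flipK_TbalOf_combSym_of_reflLettersRem`** (generic `Js⁰`) and **`axisReflectionCovariant_flipK_TbalOf_JsB12CombShSym_of_reflLettersRem`**:
  `∀ j, AxisReflectionCovariant (flipK (TbalOf Lc … j))` ⟸ EXACTLY the jet letters of the UNDRESSED jets against the legged border `𝕄′_j := bhKStepSh 3 Lc (Dsh Lc) j`:
  (St)(Wt) (THEOREMS for the literal: `JsB12CombSh0_S∕W_translate`), (Sr-conj) with DIAGONAL first-order contacts `diagK (c j α κ u)` (class `LocStencil`),
  (Wr-conj-rem) with DIAGONAL second-order contacts `diagK (x₂ j α μ y ν y′)` (class `Loc`) and a remainder `Rm j α μ y ν y′` (class `Loc`) of ZERO TADPOLE against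
  `G′_j`: `tadpole (GcombSh Lc j) (Rm j α μ y ν y′) = 0` — the ONLY scalar identity displayed (an3 XAN262-AN3 §2 P4's `hcomp^{(III′)}` shape); every kernel-side
  and inverse-side socket of the generic END is a THEOREM here (decay ∕ block covariance ∕ reflection invariance of `G′_j`, spreads, P2, diagonal commutation).
* §4 **`d1Drift_JsB12CombShSym_of_hW_reflLettersRem_D1Tel_D1Rep`**: `D1Drift Lc (JsB12CombShSym …) Nc μ ν` ⟸ EXACTLY {`hW` (Ward transversality of the family, a
  direct BINDER here), (Sr-conj), (Wr-conj-rem) + `hRm0`, `D1Tel Lc (JsB12CombShSym …) Jc`, `D1Rep Lc Jc Nc μ ν a SL k`, B5 `h12`∕`h126`, window, `μ ≠ ν`, `Nc ≠ 0`,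
  `2 ≤ Lc`, `Odd Lc`}.
COMPARE chart (II)'s ROOT E (`RowD1JointEndSym.axisReflectionCovariant_dressSymCtr`): there the second-order letter carries a COMPENSATOR `Wc` and the END displays
`hcomp : ½·tadpole G_j (Wc …) + conjDefect G_j (𝕄 j) (…) = 0`; here the contacts commute with the COORDINATE slice `axEc ρ_c` (they are diagonal), so an5's
chart-conjugation defect words never form and the remainder enters through its tadpole alone.
HONEST: composition by name; the jet letters (Sr-conj)(Wr-conj-rem)+`hRm0`, `hW`, `D1Tel`, `D1Rep` are displayed BINDERS, none proved here or anywhere in the tree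
for the (III′) literal; root-level classes of the repair track {hW, hR-letters + hRm0, D1Tel, D1Rep}: 0∕4 discharged; row D1 binders 0∕4; NOT D1, NOT `BetaPertH`,
NOT continuum, NOT Clay.
Provenance: β sub-cell, unit beta-an2 gen 36, 2026-08-22 (v1); over `CombChartStepJets` (P3, gen 35), `RelInvCombShiftedSpread` (P2, gen 35),
`CombChartResolventRules` (P1), `ChartConjugationRemainderEnd` (gen 17), `SymmetrisedDressingHessian` ∕ `AxialDressingRootedHessian` (the two dressed-kernel
identities), leaf-03's `DiagonalContact` BY NAME; no existing file touched.
-/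

noncomputable section

open Finset
open scoped BigOperators
open Literature.MathematicalPhysics.QuantumFieldTheory
open Literature.MathematicalPhysics.QuantumFieldTheory.Balaban1983to89
open Literature.MathematicalPhysics.QuantumFieldTheory.Balaban1983to89.Beta
open Literature.MathematicalPhysics.QuantumFieldTheory.Balaban1983to89.Beta.VectorTailsLoc (fam kfam)
open Literature.MathematicalPhysics.QuantumFieldTheory.Balaban1983to89.Beta.VectorLegVolumeAdapter (MvE)
open ExpKernelCalculus (MKer Decays BiLoc comp tr tadpole hessKer shiftK)
open AffineAveraging (box toSite)
open AveragingContoursRooted (ctr ctrOff ctrOff_mem_box)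
open PolarizationSign (reflSign WardTransversal AxisReflectionCovariant)
open KernelReflection (refK)
open ResolventReflection (bref Φ)
open OneStepResolventKernel (Fib LocStencil JetData)
open OneStepKernelFamily (KInvStep vertexOfK TstepOf TbalOf flipK D1Tel D1Rep D1Drift d1Drift_of_D1Tel_D1Rep)
open Summit.QuantumFields.BalabanUV.Beta.TameKernelCalculus
open Summit.QuantumFields.BalabanUV.Beta.ChartConjugation (conjV conjW)
open Summit.QuantumFields.BalabanUV.Beta.ChartConjugationRelative (RelInv)
open Summit.QuantumFields.BalabanUV.Beta.ChartConjugationRemainderEnd (axisReflectionCovariant_flipK_hessKer_conj_rem_rel)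
open Summit.QuantumFields.BalabanUV.Beta.AxialDressingRooted (one_le_of_neZero dressAt coDressKAt axEc spr_axEc hessKer_dressAt)
open Summit.QuantumFields.BalabanUV.Beta.SymmetrisedDressingKernel (coDressKSymAt)
open Summit.QuantumFields.BalabanUV.Beta.SymmetrisedDressingDress (dressSymAt)
open Summit.QuantumFields.BalabanUV.Beta.SymmetrisedDressingHessian (TstepOf_dressSymAt decays_coDressKSymAt_KInvStep)
open Summit.QuantumFields.BalabanUV.Beta.SymmetrisedStepJets (SymTables Gsym)
open Summit.QuantumFields.BalabanUV.Beta.SymShiftedSpread (bhKStepSh spr_bhKStepSh)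
open Summit.QuantumFields.BalabanUV.Beta.DshAn1 (Dsh spr_Dsh)
open Summit.QuantumFields.BalabanUV.Beta.BorderedHessian (diagK comp_axEc_diagK_comm)
open Summit.QuantumFields.BalabanUV.Beta.CombChartResolventRules (refK_coDressKAt_Gsym)
open Summit.QuantumFields.BalabanUV.Beta.CombChartStepJets (GcombSh decays_GcombSh shiftK_GcombSh JsB12CombSh0 JsB12CombSh JsB12CombSh0_S_translate
  JsB12CombSh0_W_translate)
open Summit.QuantumFields.BalabanUV.Beta.RelInvCombShiftedSpread (relInv_coDressKAt_Gsym_bhKStepSh)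

namespace Summit.QuantumFields.BalabanUV.Beta.CombChartJointEnd

variable {Lc : ℕ} [NeZero Lc]

/-! ## §1 The END-ready chart-(III′) literal `JsB12CombShSym := dressSymAt ρ_c ∘ JsB12CombSh` -/

/-- [our object — THE CHART-(III′) LITERAL of BINDER row D1's repair track, END-ready form] **`JsB12CombShSym := dressSymAt ρ_c ∘ JsB12CombSh`**
(`= dressSymAt ρ_c ∘ dressAt ρ_c ∘ JsB12CombSh⁰`): P3's comb-dressed literal dressed once more by the centred block-mean sym dressing, so that its Hessian
kernel's resolvent is `GcombSh Lc j` (§2).  A NAME over a displayed table record, asserting nothing. -/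
def JsB12CombShSym (hLc : Odd Lc) (N : ℕ) (tabs : SymTables 3 Lc) (cΛ cB : ℝ) : ℕ → JetData 3 Lc := fun j =>
  dressSymAt (ctrOff_mem_box (d := 4) (one_le_of_neZero Lc)) (JsB12CombSh hLc N tabs cΛ cB j)

/-- [folklore] `JsB12CombShSym` is `dressSymAt ρ_c ∘ JsB12CombSh` (`rfl`). -/
theorem JsB12CombShSym_apply (hLc : Odd Lc) (N : ℕ) (tabs : SymTables 3 Lc) (cΛ cB : ℝ) (j : ℕ) :
    JsB12CombShSym hLc N tabs cΛ cB j = dressSymAt (ctrOff_mem_box (d := 4) (one_le_of_neZero Lc)) (JsB12CombSh hLc N tabs cΛ cB j) := rfl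

/-- [folklore] `JsB12CombShSym` is `dressSymAt ρ_c ∘ dressAt ρ_c ∘ JsB12CombSh⁰` (`rfl`). -/
theorem JsB12CombShSym_eq (hLc : Odd Lc) (N : ℕ) (tabs : SymTables 3 Lc) (cΛ cB : ℝ) (j : ℕ) :
    JsB12CombShSym hLc N tabs cΛ cB j =
      dressSymAt (ctrOff_mem_box (d := 4) (one_le_of_neZero Lc))
        (dressAt (ctrOff_mem_box (d := 4) (one_le_of_neZero Lc)) (JsB12CombSh0 hLc N tabs cΛ cB j)) := rfl

/-! ## §2 The kernel identity: the Hessian kernel of the doubly dressed family has resolvent `G′_j = GcombSh Lc j` -/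

/-- [folklore] **THE DOUBLY-DRESSED KERNEL IDENTITY (every step `j`, any undressed jets).**  For `Js⁰ : ℕ → JetData 3 Lc`:
`TbalOf Lc (dressSymAt ρ_c ∘ dressAt ρ_c ∘ Js⁰) j = hessKer G′_j (vertexOfK G′_j Lc (Js⁰ j).S) (Js⁰ j).W`, `G′_j := GcombSh Lc j = coDressKAt ρ_c Lc (Gsym Lc j)` —
`SymmetrisedDressingHessian.TstepOf_dressSymAt` (outer functor ↦ `Gsym Lc j`) then `AxialDressingRootedHessian.hessKer_dressAt` at the decaying kernel `Gsym Lc j`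
(inner functor ↦ `coDressKAt ρ_c Lc (Gsym Lc j)`). -/
theorem TbalOf_dressSymAt_dressAt (Js : ℕ → JetData 3 Lc) (j : ℕ) :
    TbalOf Lc (fun j => dressSymAt (ctrOff_mem_box (d := 4) (one_le_of_neZero Lc))
        (dressAt (ctrOff_mem_box (d := 4) (one_le_of_neZero Lc)) (Js j))) j =
      hessKer (GcombSh Lc j) (vertexOfK (GcombSh Lc j) Lc (Js j).S) (Js j).W := by
  show TstepOf Lc j (dressSymAt (ctrOff_mem_box (d := 4) (one_le_of_neZero Lc))
      (dressAt (ctrOff_mem_box (d := 4) (one_le_of_neZero Lc)) (Js j))) = _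
  rw [TstepOf_dressSymAt]
  exact hessKer_dressAt (ctrOff_mem_box (d := 4) (one_le_of_neZero Lc))
    (decays_coDressKSymAt_KInvStep (ctrOff_mem_box (d := 4) (one_le_of_neZero Lc)) j) (Js j)

/-- [folklore] **THE KERNEL IDENTITY FOR THE (III′) LITERAL**: `TbalOf Lc (JsB12CombShSym …) j = hessKer G′_j (vertexOfK G′_j Lc (JsB12CombSh⁰ … j).S) (JsB12CombSh⁰ … j).W`. -/
theorem TbalOf_JsB12CombShSym (hLc : Odd Lc) (N : ℕ) (tabs : SymTables 3 Lc) (cΛ cB : ℝ) (j : ℕ) :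
    TbalOf Lc (JsB12CombShSym hLc N tabs cΛ cB) j =
      hessKer (GcombSh Lc j) (vertexOfK (GcombSh Lc j) Lc (JsB12CombSh0 hLc N tabs cΛ cB j).S) (JsB12CombSh0 hLc N tabs cΛ cB j).W :=
  TbalOf_dressSymAt_dressAt (fun j => JsB12CombSh0 hLc N tabs cΛ cB j) j

/-! ## §3 hR for the doubly dressed family from the reflection letters of the undressed jets — relative sockets DISCHARGED, diagonal contacts, tadpole-null remainder -/

/-- [folklore] **hR FOR `dressSymAt ρ_c ∘ dressAt ρ_c ∘ Js⁰` OVER THE CHART-(III′) TRIPLE, SOCKETS DISCHARGED.**  `Odd Lc`; undressed jets `Js⁰` with (St)(Wt);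
DIAGONAL first-order contacts `diagK (c j α κ u)` (uniform `LocStencil` class per level) and second-order contacts `diagK (x₂ j α μ y ν y′)` (`Loc`); a remainder
`Rm j α μ y ν y′` (`Loc`) with `tadpole (GcombSh Lc j) (Rm …) = 0`; the reflection letters (Sr-conj), (Wr-conj-rem) of `Js⁰` against the legged border
`bhKStepSh 3 Lc (Dsh Lc) j` with the `ℋ`-columns of `GcombSh Lc j`.  CONCLUSION: `∀ j, AxisReflectionCovariant (flipK (TbalOf Lc (dressSymAt ρ_c ∘ dressAt ρ_c ∘ Js⁰) j))`.
Kernel side (`decays_GcombSh`, `shiftK_GcombSh`, `refK_coDressKAt_Gsym`), inverse side (P2 `relInv_coDressKAt_Gsym_bhKStepSh`, `spr_bhKStepSh (spr_Dsh)`, `spr_axEc`)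
and the commutations with the coordinate slice (`comp_axEc_diagK_comm`) are THEOREMS; no compensator, no `conjDefect`. -/
theorem axisReflectionCovariant_flipK_TbalOf_combSym_of_reflLettersRem (hLc : Odd Lc) (Js : ℕ → JetData 3 Lc)
    (hSt : ∀ (j : ℕ) (κ' : Fin 4) (u t : Fin 4 → ℤ), (Js j).S κ' (u + (Lc : ℤ) • t) = ExpKernelCalculus.shiftK (-((Lc : ℤ) • t)) ((Js j).S κ' u))
    (hWt : ∀ (j : ℕ) (μ : Fin 4) (y : Fin 4 → ℤ) (ν : Fin 4) (y' t : Fin 4 → ℤ),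
      (Js j).W μ (y + t) ν (y' + t) = ExpKernelCalculus.shiftK (-((Lc : ℤ) • t)) ((Js j).W μ y ν y'))
    (c : ℕ → Fin 4 → Fin 4 → (Fin 4 → ℤ) → (Fin 4 → ℤ) → Fib 3 → ℝ) (Cc δc : ℕ → ℝ)
    (hC : ∀ j α, LocStencil (fun κ u => diagK (c j α κ u)) (Cc j) (δc j)) (hδc : ∀ j, 0 < δc j)
    (x₂ : ℕ → Fin 4 → Fin 4 → (Fin 4 → ℤ) → Fin 4 → (Fin 4 → ℤ) → (Fin 4 → ℤ) → Fib 3 → ℝ)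
    (hX₂ : ∀ j α μ y ν y', Loc (diagK (x₂ j α μ y ν y')))
    (Rm : ℕ → Fin 4 → Fin 4 → (Fin 4 → ℤ) → Fin 4 → (Fin 4 → ℤ) → MKer 4 (Fib 3))
    (hRmL : ∀ j α μ y ν y', Loc (Rm j α μ y ν y'))
    (hRm0 : ∀ j α μ y ν y', tadpole (GcombSh Lc j) (Rm j α μ y ν y') = 0)
    (hSrC : ∀ (j : ℕ) (α κ' : Fin 4) (u : Fin 4 → ℤ),
      (Js j).S κ' (bref α κ' u) = reflSign α κ' • refK (Φ Lc α) ((Js j).S κ' u + conjV (bhKStepSh 3 Lc (Dsh Lc) j) (diagK (c j α κ' u))))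
    (hWrC : ∀ (j : ℕ) (α μ : Fin 4) (y : Fin 4 → ℤ) (ν : Fin 4) (y' : Fin 4 → ℤ),
      (Js j).W μ (bref α μ y) ν (bref α ν y') = (reflSign α μ * reflSign α ν) • refK (Φ Lc α) ((Js j).W μ y ν y' +
        conjW (bhKStepSh 3 Lc (Dsh Lc) j) (vertexOfK (GcombSh Lc j) Lc (Js j).S μ y) (vertexOfK (GcombSh Lc j) Lc (Js j).S ν y')
          (vertexOfK (GcombSh Lc j) Lc (fun κ u => diagK (c j α κ u)) μ y) (vertexOfK (GcombSh Lc j) Lc (fun κ u => diagK (c j α κ u)) ν y')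
          (diagK (x₂ j α μ y ν y')) + Rm j α μ y ν y')) :
    ∀ j : ℕ, AxisReflectionCovariant (flipK (TbalOf Lc (fun j => dressSymAt (ctrOff_mem_box (d := 4) (one_le_of_neZero Lc))
        (dressAt (ctrOff_mem_box (d := 4) (one_le_of_neZero Lc)) (Js j))) j)) := by
  intro j
  rw [TbalOf_dressSymAt_dressAt Js j]
  exact axisReflectionCovariant_flipK_hessKer_conj_rem_rel (decays_GcombSh Lc j) (shiftK_GcombSh Lc j) (fun α => refK_coDressKAt_Gsym hLc j α)
    (spr_bhKStepSh (spr_Dsh (one_le_of_neZero Lc)) j) (spr_axEc _ _) (relInv_coDressKAt_Gsym_bhKStepSh j) (Js j) (hSt j) (hWt j)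
    (fun α κ u => diagK (c j α κ u)) (hC j) (hδc j) (fun α μ y ν y' => diagK (x₂ j α μ y ν y')) (Rm j) (hX₂ j)
    (fun α κ' u => comp_axEc_diagK_comm _ _ _) (fun α μ y ν y' => comp_axEc_diagK_comm _ _ _) (hRmL j) (hRm0 j) (hSrC j) (hWrC j)

/-- [folklore] **hR FOR THE CHART-(III′) LITERAL `JsB12CombShSym` FROM ITS UNDRESSED JET LETTERS** — §3's generic END at `Js⁰ := JsB12CombSh⁰ hLc N tabs cΛ cB` with
(St)(Wt) DISCHARGED (`JsB12CombSh0_S_translate` ∕ `JsB12CombSh0_W_translate`).  Displayed: (Sr-conj), (Wr-conj-rem), `hRm0` — nothing else. -/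
theorem axisReflectionCovariant_flipK_TbalOf_JsB12CombShSym_of_reflLettersRem (hLc : Odd Lc) (N : ℕ) (tabs : SymTables 3 Lc) (cΛ cB : ℝ)
    (c : ℕ → Fin 4 → Fin 4 → (Fin 4 → ℤ) → (Fin 4 → ℤ) → Fib 3 → ℝ) (Cc δc : ℕ → ℝ)
    (hC : ∀ j α, LocStencil (fun κ u => diagK (c j α κ u)) (Cc j) (δc j)) (hδc : ∀ j, 0 < δc j)
    (x₂ : ℕ → Fin 4 → Fin 4 → (Fin 4 → ℤ) → Fin 4 → (Fin 4 → ℤ) → (Fin 4 → ℤ) → Fib 3 → ℝ)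
    (hX₂ : ∀ j α μ y ν y', Loc (diagK (x₂ j α μ y ν y')))
    (Rm : ℕ → Fin 4 → Fin 4 → (Fin 4 → ℤ) → Fin 4 → (Fin 4 → ℤ) → MKer 4 (Fib 3))
    (hRmL : ∀ j α μ y ν y', Loc (Rm j α μ y ν y'))
    (hRm0 : ∀ j α μ y ν y', tadpole (GcombSh Lc j) (Rm j α μ y ν y') = 0)
    (hSrC : ∀ (j : ℕ) (α κ' : Fin 4) (u : Fin 4 → ℤ),
      (JsB12CombSh0 hLc N tabs cΛ cB j).S κ' (bref α κ' u) =
        reflSign α κ' • refK (Φ Lc α) ((JsB12CombSh0 hLc N tabs cΛ cB j).S κ' u + conjV (bhKStepSh 3 Lc (Dsh Lc) j) (diagK (c j α κ' u))))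
    (hWrC : ∀ (j : ℕ) (α μ : Fin 4) (y : Fin 4 → ℤ) (ν : Fin 4) (y' : Fin 4 → ℤ),
      (JsB12CombSh0 hLc N tabs cΛ cB j).W μ (bref α μ y) ν (bref α ν y') = (reflSign α μ * reflSign α ν) • refK (Φ Lc α)
        ((JsB12CombSh0 hLc N tabs cΛ cB j).W μ y ν y' +
          conjW (bhKStepSh 3 Lc (Dsh Lc) j) (vertexOfK (GcombSh Lc j) Lc (JsB12CombSh0 hLc N tabs cΛ cB j).S μ y)
            (vertexOfK (GcombSh Lc j) Lc (JsB12CombSh0 hLc N tabs cΛ cB j).S ν y')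
            (vertexOfK (GcombSh Lc j) Lc (fun κ u => diagK (c j α κ u)) μ y) (vertexOfK (GcombSh Lc j) Lc (fun κ u => diagK (c j α κ u)) ν y')
            (diagK (x₂ j α μ y ν y')) + Rm j α μ y ν y')) :
    ∀ j : ℕ, AxisReflectionCovariant (flipK (TbalOf Lc (JsB12CombShSym hLc N tabs cΛ cB) j)) :=
  axisReflectionCovariant_flipK_TbalOf_combSym_of_reflLettersRem hLc (fun j => JsB12CombSh0 hLc N tabs cΛ cB j)
    (fun j κ' u t => JsB12CombSh0_S_translate hLc N tabs cΛ cB j κ' u t) (fun j μ y ν y' t => JsB12CombSh0_W_translate hLc N tabs cΛ cB j μ y ν y' t)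
    c Cc δc hC hδc x₂ hX₂ Rm hRmL hRm0 hSrC hWrC

/-! ## §4 The row's END at JetData level for the chart-(III′) literal -/

/-- **ROW D1, CHART-(III′) LITERAL, JetData-LEVEL END: `D1Drift Lc (JsB12CombShSym …) Nc μ ν ⟸ hW ∧ (Sr-conj) ∧ (Wr-conj-rem) ∧ hRm0 ∧ D1Tel ∧ D1Rep`**
(+ the route theorem's own binders: printed B5 facts `h12`∕`h126`, window, `μ ≠ ν`, `Nc ≠ 0`, `2 ≤ Lc`; `Odd Lc`) — `OneStepKernelFamily.d1Drift_of_D1Tel_D1Rep` at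
`Js := JsB12CombShSym hLc N tabs cΛ cB` with `hR` SUPPLIED by §3.  The colour parameter `Nc` is left free.  HONEST: no binder of the row is proved here; for the
repair track the root-level classes {hW, hR-letters + `hRm0`, D1Tel, D1Rep} are 0∕4 discharged; NOT D1, NOT `BetaPertH`, NOT continuum, NOT Clay. -/
theorem d1Drift_JsB12CombShSym_of_hW_reflLettersRem_D1Tel_D1Rep (hLc : Odd Lc) (hL2 : 2 ≤ Lc) (N : ℕ) (tabs : SymTables 3 Lc) (cΛ cB : ℝ)
    -- hW: a direct binder (the (III′) Ward END is not in this file)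
    (hW : ∀ j, WardTransversal (flipK (TbalOf Lc (JsB12CombShSym hLc N tabs cΛ cB) j)))
    -- hR: the reflection letters of the undressed comb-chart jets, diagonal contacts, tadpole-null remainder
    (c : ℕ → Fin 4 → Fin 4 → (Fin 4 → ℤ) → (Fin 4 → ℤ) → Fib 3 → ℝ) (Cc δc : ℕ → ℝ)
    (hC : ∀ j α, LocStencil (fun κ u => diagK (c j α κ u)) (Cc j) (δc j)) (hδc : ∀ j, 0 < δc j)
    (x₂ : ℕ → Fin 4 → Fin 4 → (Fin 4 → ℤ) → Fin 4 → (Fin 4 → ℤ) → (Fin 4 → ℤ) → Fib 3 → ℝ)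
    (hX₂ : ∀ j α μ y ν y', Loc (diagK (x₂ j α μ y ν y')))
    (Rm : ℕ → Fin 4 → Fin 4 → (Fin 4 → ℤ) → Fin 4 → (Fin 4 → ℤ) → MKer 4 (Fib 3))
    (hRmL : ∀ j α μ y ν y', Loc (Rm j α μ y ν y'))
    (hRm0 : ∀ j α μ y ν y', tadpole (GcombSh Lc j) (Rm j α μ y ν y') = 0)
    (hSrC : ∀ (j : ℕ) (α κ' : Fin 4) (u : Fin 4 → ℤ),
      (JsB12CombSh0 hLc N tabs cΛ cB j).S κ' (bref α κ' u) =
        reflSign α κ' • refK (Φ Lc α) ((JsB12CombSh0 hLc N tabs cΛ cB j).S κ' u + conjV (bhKStepSh 3 Lc (Dsh Lc) j) (diagK (c j α κ' u))))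
    (hWrC : ∀ (j : ℕ) (α μ : Fin 4) (y : Fin 4 → ℤ) (ν : Fin 4) (y' : Fin 4 → ℤ),
      (JsB12CombSh0 hLc N tabs cΛ cB j).W μ (bref α μ y) ν (bref α ν y') = (reflSign α μ * reflSign α ν) • refK (Φ Lc α)
        ((JsB12CombSh0 hLc N tabs cΛ cB j).W μ y ν y' +
          conjW (bhKStepSh 3 Lc (Dsh Lc) j) (vertexOfK (GcombSh Lc j) Lc (JsB12CombSh0 hLc N tabs cΛ cB j).S μ y)
            (vertexOfK (GcombSh Lc j) Lc (JsB12CombSh0 hLc N tabs cΛ cB j).S ν y')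
            (vertexOfK (GcombSh Lc j) Lc (fun κ u => diagK (c j α κ u)) μ y) (vertexOfK (GcombSh Lc j) Lc (fun κ u => diagK (c j α κ u)) ν y')
            (diagK (x₂ j α μ y ν y')) + Rm j α μ y ν y'))
    -- the route theorem's own binders (printed B5 facts, channel, colour parameter, window), verbatim
    (a : ℝ) (ha : 0 < a)
    (h12 : B5.Prop12Printed (fam (fun i : ℕ+ × ℕ => ((i.1 : ℕ+) : ℕ)) (fun i => i.1.pos) MvE a ha))
    (h126 : B5.Kernel126_127Printed (kfam (fun i : ℕ+ × ℕ => ((i.1 : ℕ+) : ℕ)) MvE))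
    {L : Type*} {SL : Finset L} (hSL : SL.Nonempty) (k : L → Fin 4) {μ ν : Fin 4} (hμν : μ ≠ ν) {Nc : ℝ} (hNc : Nc ≠ 0)
    (Jc : ∀ m : ℕ, JetData 3 (Lc ^ m)) (htel : D1Tel Lc (JsB12CombShSym hLc N tabs cΛ cB) Jc)
    {cc : ℝ} {Mw : ℕ → ℕ} (hc : 1 ≤ cc) (hMw : ∀ L : ℕ, 2 ≤ L → 1 ≤ Mw L ∧ (L : ℝ) ≤ cc * Mw L) (hML : ∀ L : ℕ, 2 ≤ L → Mw L ≤ L)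
    (hrep : D1Rep Lc Jc Nc μ ν a SL k) :
    D1Drift Lc (JsB12CombShSym hLc N tabs cΛ cB) Nc μ ν :=
  d1Drift_of_D1Tel_D1Rep a ha h12 h126 hSL k hμν hNc hL2 _ Jc hW
    (axisReflectionCovariant_flipK_TbalOf_JsB12CombShSym_of_reflLettersRem hLc N tabs cΛ cB c Cc δc hC hδc x₂ hX₂ Rm hRmL hRm0 hSrC hWrC)
    htel hc hMw hML hrep

end Summit.QuantumFields.BalabanUV.Beta.CombChartJointEnd

end
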